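import Literature.MathematicalPhysics.QuantumLattice.InfiniteVolumeChainEnergyProofs
import Literature.MathematicalPhysics.QuantumLattice.InfiniteVolumeChainRegionProofs
import HarnessLib

/-!
# The local twist `Û_ℓ` of the Heisenberg chain, its translate, and the uniform rotation

Trunk **T-QLATTICE**. Proof file behind the named fact
`Literature.MathematicalPhysics.QuantumLattice.no_unique_gapped_groundState_halfOddSpin`
(`InfiniteVolume.lean`): the concrete twists of the Affleck–Lieb argument on the block
`Λ_ℓ = {1, …, ℓ} ⊆ ℤ`, staged in `Λ'_ℓ = {0, …, ℓ+1} ⊇ (Λ_ℓ)_1`: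

* `Û_ℓ = twistOp θ^U`, `θ^U_x = 2πx/ℓ` on `Λ_ℓ` — the local twist operator `Û_{0,ℓ}` of Tasaki
  (2022) §3.1 (extended by the identity) — and the uniform rotation
  `Ŵ_α = twistOp (x ↦ α) = exp[-iα Σ_{x∈Λ_ℓ}(Ŝᶻ_x + S)]`;
* `conjTranspose_twistU_mul_translate` — **the twist/translation identity**
  `Û_ℓᴴ · 𝒯₁(Û_ℓ) = Ŵ_{-2π/ℓ}` (as operators on `Λ'_ℓ`; the site `ℓ+1` carries the angle `2π`,
  which acts trivially): Tasaki (2022), proof of Lemma 3.3, eq. `Û_{x,ℓ} = e^{i2πx ν̂_ℓ} Û_{0,ℓ}`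
  at `x = 1`, equivalently Tasaki (2018) Lemma 2, `T̂ᴴ Û_ℓ T̂ = exp[2πi ρ̂_ℓ] Û_ℓ`;
* `gap_mul_le_twistU`, `gap_mul_le_twistW` — the variational estimate of
  `InfiniteVolumeChainEnergyProofs` evaluated for these twists: all bond phases are `0`, `±2π/ℓ`,
  `2π` (resp. `0`, `±α`), so `γ(1 - |ω(Û_ℓ)|²)` and `γ(1 - |ω(Ŵ_α)|²)` (`|α| ≤ 2π/ℓ`) are at most
  `|J| |c₀| (ℓ+2) 4π²/ℓ²` (Tasaki 2022, Lemma 3.1 `≤ C/ℓ` and Lemma 3.2);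
* `re_expect_twistU_translate_ge` — the near-eigenvector estimate combined with translation
  invariance: `re ω(Û_ℓᴴ 𝒯₁(Û_ℓ)) ≥ |ω(Û_ℓ)|² - (1 - |ω(Û_ℓ)|²)^{1/2}`;
* `conj_expect_twistW` — flip invariance and Hermiticity make `e^{inℓα/2} ω(Ŵ_α)` **real**
  (`flip (Ŵ_α) = e^{-inℓα} Ŵ_{-α}`, `ω(Ŵ_{-α}) = conj ω(Ŵ_α)`), the input replacing Tasaki's
  winding-number/filling argument for the `U(1) ⋊ ℤ₂`-symmetric chain.

No statement of any other file is changed and no definition is introduced.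

## References

* H. Tasaki, *The Lieb–Schultz–Mattis theorem. A topological point of view*, in: The Physics
  and Mathematics of Elliott Lieb, vol. 2, EMS Press (2022) 405–446, arXiv:2202.06243 (held),
  §3.1 (local twist, Lemma 3.1, Lemma 3.2), §3.2 (proof of Lemma 3.3: `Û_{x,ℓ} = e^{i2πxν̂_ℓ}Û_{0,ℓ}`),
  Cor. 3.6. [Tasaki2022]
* H. Tasaki, J. Stat. Phys. 170 (2018) 653–671, arXiv:1708.05186 (held), Lemma 2
  (`T̂ᴴÛ_ℓT̂ = exp[2πiρ̂_ℓ]Û_ℓ`). [Tasaki2018]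
-/

noncomputable section

open Matrix Complex Finset
open scoped ComplexOrder

namespace Literature.MathematicalPhysics.QuantumLattice

open Literature.Probability.LatticeModels
open Literature.Probability.LatticeModels (Site box mem_box)

section Chain

variable (n : ℕ) (J : ℝ) (ℓ : ℕ)

/-! ### The twist/translation identity `Û_ℓᴴ 𝒯₁(Û_ℓ) = Ŵ_{-2π/ℓ}` -/

/-- **The twist/translation identity.** On the stage `Λ' = {0,…,ℓ+1}`, the local twist
`Û_ℓ = exp[-i Σ_{x=1}^{ℓ} (2πx/ℓ)(Ŝᶻ_x + S)]` and its translate by one site satisfy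
`Û_ℓᴴ · 𝒯₁(Û_ℓ) = Ŵ_{-2π/ℓ} = exp[+i(2π/ℓ) Σ_{x=1}^{ℓ}(Ŝᶻ_x + S)]`: the angle differences are
`-2π/ℓ` on `{1,…,ℓ}` and `2π` at the site `ℓ+1`, where `exp[-i2π(Ŝᶻ+S)] = 1`
(`twistOp_eq_one_of_int`). This is `Û_{1,ℓ} = e^{i2πν̂_ℓ} Û_{0,ℓ}` from the proof of Tasaki (2022)
Lemma 3.3 (equivalently `T̂ᴴÛ_ℓT̂ = exp[2πiρ̂_ℓ]Û_ℓ`, Tasaki 2018, Lemma 2).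
[cite: Tasaki2022, §3.2 Lemma 3.3 (proof)] -/
theorem conjTranspose_twistU_mul_translate (hℓ : 1 ≤ ℓ) :
    (embedOp (Icc_subset_Icc' ℓ) (twistOp fun x : ↥(Finset.Icc (1 : Site 1) (ℓ : Site 1)) =>
        2 * Real.pi * ((x : Site 1) 0 : ℝ) / ℓ) : Op ↥(Finset.Icc (0 : Site 1) ((ℓ : Site 1) + 1)) (n + 1))ᴴ *
      embedOp (map_shift_Icc_subset ℓ)
        (transportOp (finsetMapEquiv (Site.shift (1 : Site 1)).toEmbedding
          (Finset.Icc (1 : Site 1) (ℓ : Site 1)))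
          (twistOp fun x : ↥(Finset.Icc (1 : Site 1) (ℓ : Site 1)) =>
            2 * Real.pi * ((x : Site 1) 0 : ℝ) / ℓ)) =
      embedOp (Icc_subset_Icc' ℓ)
        (twistOp fun _ : ↥(Finset.Icc (1 : Site 1) (ℓ : Site 1)) => -(2 * Real.pi / ℓ)) := by
  have hℓ0 : (ℓ : ℝ) ≠ 0 := by exact_mod_cast (Nat.one_le_iff_ne_zero.mp hℓ)
  rw [transportOp_twistOp, embedOp_twistOp, embedOp_twistOp, embedOp_twistOp,
    twistOp_conjTranspose, ← twistOp_add]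
  -- the combined angle is `-2π/ℓ` on the block plus a multiple of `2π`
  set m : ↥(Finset.Icc (0 : Site 1) ((ℓ : Site 1) + 1)) → ℤ :=
    fun z => if (z : Site 1) 0 = ℓ + 1 then 1 else 0 with hm
  have key : ((-fun y : ↥(Finset.Icc (0 : Site 1) ((ℓ : Site 1) + 1)) =>
        if hy : (y : Site 1) ∈ Finset.Icc (1 : Site 1) (ℓ : Site 1) then
          2 * Real.pi * (((⟨y, hy⟩ : ↥(Finset.Icc (1 : Site 1) (ℓ : Site 1))) : Site 1) 0 : ℝ) / ℓ
        else 0) +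
      fun y : ↥(Finset.Icc (0 : Site 1) ((ℓ : Site 1) + 1)) =>
        if hy : (y : Site 1) ∈ (Finset.Icc (1 : Site 1) (ℓ : Site 1)).map
            (Site.shift (1 : Site 1)).toEmbedding then
          2 * Real.pi * ((((finsetMapEquiv (Site.shift (1 : Site 1)).toEmbedding
            (Finset.Icc (1 : Site 1) (ℓ : Site 1))).symm ⟨y, hy⟩ :
              ↥(Finset.Icc (1 : Site 1) (ℓ : Site 1))) : Site 1) 0 : ℝ) / ℓ
        else 0) =
      (fun y : ↥(Finset.Icc (0 : Site 1) ((ℓ : Site 1) + 1)) =>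
        if hy : (y : Site 1) ∈ Finset.Icc (1 : Site 1) (ℓ : Site 1) then -(2 * Real.pi / ℓ) else 0) +
      fun y => 2 * Real.pi * (m y : ℝ) := by
    funext z
    simp only [Pi.add_apply, Pi.neg_apply, hm]
    have hz := z.2
    rw [Site.mem_Icc_iff] at hz
    simp only [Pi.add_apply, Pi.natCast_apply, Pi.one_apply, Pi.zero_apply] at hz
    have hmemΛ : ((z : Site 1) ∈ Finset.Icc (1 : Site 1) (ℓ : Site 1)) ↔
        1 ≤ (z : Site 1) 0 ∧ (z : Site 1) 0 ≤ ℓ := by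
      rw [Site.mem_Icc_iff]; simp only [Pi.natCast_apply, Pi.one_apply]
    have hmemΛ' : ((z : Site 1) ∈ (Finset.Icc (1 : Site 1) (ℓ : Site 1)).map
        (Site.shift (1 : Site 1)).toEmbedding) ↔
        1 ≤ (z : Site 1) 0 - 1 ∧ (z : Site 1) 0 - 1 ≤ ℓ := by
      rw [Site.mem_map_shift_iff, Site.mem_Icc_iff]
      simp only [Pi.sub_apply, Pi.natCast_apply, Pi.one_apply]
    by_cases hzΛ : (z : Site 1) ∈ Finset.Icc (1 : Site 1) (ℓ : Site 1) <;>
      by_cases hzΛ' : (z : Site 1) ∈ (Finset.Icc (1 : Site 1) (ℓ : Site 1)).map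
        (Site.shift (1 : Site 1)).toEmbedding
    · have h1 := hmemΛ.1 hzΛ
      have h2 := hmemΛ'.1 hzΛ'
      rw [dif_pos hzΛ, dif_pos hzΛ', dif_pos hzΛ, coe_finsetMapEquiv_shift_symm_apply,
        if_neg (by omega)]
      simp only [Pi.sub_apply, Pi.one_apply, Int.cast_sub, Int.cast_one, Int.cast_zero]
      ring
    · have h1 := hmemΛ.1 hzΛ
      have h2 : ¬(1 ≤ (z : Site 1) 0 - 1 ∧ (z : Site 1) 0 - 1 ≤ ℓ) := fun h => hzΛ' (hmemΛ'.2 h)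
      rw [dif_pos hzΛ, dif_neg hzΛ', dif_pos hzΛ, if_neg (by omega)]
      have hz1 : ((z : Site 1) 0 : ℝ) = 1 := by exact_mod_cast (show (z : Site 1) 0 = 1 by omega)
      rw [hz1]
      simp only [Int.cast_zero]
      ring
    · have h1 : ¬(1 ≤ (z : Site 1) 0 ∧ (z : Site 1) 0 ≤ ℓ) := fun h => hzΛ (hmemΛ.2 h)
      have h2 := hmemΛ'.1 hzΛ'
      rw [dif_neg hzΛ, dif_pos hzΛ', dif_neg hzΛ, coe_finsetMapEquiv_shift_symm_apply,
        if_pos (by omega)]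
      have hz1 : ((z : Site 1) 0 : ℝ) = ℓ + 1 := by
        exact_mod_cast (show (z : Site 1) 0 = ℓ + 1 by omega)
      simp only [Pi.sub_apply, Pi.one_apply, Int.cast_sub, Int.cast_one, hz1]
      field_simp
      ring
    · have h1 : ¬(1 ≤ (z : Site 1) 0 ∧ (z : Site 1) 0 ≤ ℓ) := fun h => hzΛ (hmemΛ.2 h)
      have h2 : ¬(1 ≤ (z : Site 1) 0 - 1 ∧ (z : Site 1) 0 - 1 ≤ ℓ) := fun h => hzΛ' (hmemΛ'.2 h)
      rw [dif_neg hzΛ, dif_neg hzΛ', dif_neg hzΛ, if_neg (by omega)]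
      simp
  rw [key, twistOp_add, twistOp_eq_one_of_int (fun z => ⟨m z, rfl⟩), mul_one]

/-! ### The variational estimate for `Û_ℓ` and `Ŵ_α` -/

/-- **Bond phases of the local twist.** For `Û_ℓ` (angles `2πx/ℓ` on `{1,…,ℓ}`, `0` elsewhere) every
bond `(x, x+1)` of the stage has `2 - 2cos(θ_x - θ_{x+1}) ≤ 4π²/ℓ²`: the difference is `-2π/ℓ`
inside and at the left end, `2π` at the right end (`cos 2π = 1`) and `0` outside. Tasaki (2022),
proof of Lemma 3.1 (`|θ_j - θ_{j+1}| ≤ 2π/ℓ` modulo `2π`). [cite: Tasaki2022, §3.1 Lemma 3.1 (proof)] -/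
theorem bond_phase_twistU_le (hℓ : 1 ≤ ℓ) (x y : ↥(Finset.Icc (0 : Site 1) ((ℓ : Site 1) + 1)))
    (hxy : (y : Site 1) = x + 1) :
    2 - 2 * Real.cos
      ((if hx : (x : Site 1) ∈ Finset.Icc (1 : Site 1) (ℓ : Site 1) then
          2 * Real.pi * (((⟨x, hx⟩ : ↥(Finset.Icc (1 : Site 1) (ℓ : Site 1))) : Site 1) 0 : ℝ) / ℓ
        else 0) -
        (if hy : (y : Site 1) ∈ Finset.Icc (1 : Site 1) (ℓ : Site 1) then
          2 * Real.pi * (((⟨y, hy⟩ : ↥(Finset.Icc (1 : Site 1) (ℓ : Site 1))) : Site 1) 0 : ℝ) / ℓ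
        else 0)) ≤ 4 * Real.pi ^ 2 / ℓ ^ 2 := by
  have hℓ0 : (ℓ : ℝ) ≠ 0 := by exact_mod_cast (Nat.one_le_iff_ne_zero.mp hℓ)
  have hB : (2 * Real.pi / ℓ) ^ 2 = 4 * Real.pi ^ 2 / ℓ ^ 2 := by ring
  have hB0 : 0 ≤ 4 * Real.pi ^ 2 / ℓ ^ 2 := by positivity
  have hy0 : (y : Site 1) 0 = (x : Site 1) 0 + 1 := by rw [hxy]; rfl
  have hx' := x.2
  have hy' := y.2
  rw [Site.mem_Icc_iff] at hx' hy'
  simp only [Pi.add_apply, Pi.natCast_apply, Pi.one_apply, Pi.zero_apply] at hx' hy'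
  by_cases hx : (x : Site 1) ∈ Finset.Icc (1 : Site 1) (ℓ : Site 1) <;>
    by_cases hy : (y : Site 1) ∈ Finset.Icc (1 : Site 1) (ℓ : Site 1)
  all_goals
    have h1 := hx; have h2 := hy
    rw [Site.mem_Icc_iff] at h1 h2
    simp only [Pi.natCast_apply, Pi.one_apply] at h1 h2
  · rw [dif_pos hx, dif_pos hy]
    have : 2 * Real.pi * ((x : Site 1) 0 : ℝ) / ℓ - 2 * Real.pi * ((y : Site 1) 0 : ℝ) / ℓ =
        -(2 * Real.pi / ℓ) := by
      rw [hy0]; push_cast; ring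
    rw [this, Real.cos_neg, ← hB]
    exact two_sub_two_mul_cos_le_sq _
  · rw [dif_pos hx, dif_neg hy, sub_zero]
    have hxl : ((x : Site 1) 0 : ℝ) = ℓ := by exact_mod_cast (show (x : Site 1) 0 = ℓ by omega)
    rw [hxl, mul_div_assoc, div_self hℓ0, mul_one, Real.cos_two_pi]
    linarith
  · rw [dif_neg hx, dif_pos hy, zero_sub, Real.cos_neg]
    have hy1 : ((y : Site 1) 0 : ℝ) = 1 := by exact_mod_cast (show (y : Site 1) 0 = 1 by omega)
    rw [hy1, mul_one, ← hB]
    exact two_sub_two_mul_cos_le_sq _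
  · rw [dif_neg hx, dif_neg hy, sub_zero, Real.cos_zero]
    linarith

/-- **Bond phases of the uniform rotation.** For `Ŵ_α` (angle `α` on `{1,…,ℓ}`, `0` elsewhere) with
`|α| ≤ 2π/ℓ`, every bond of the stage has `2 - 2cos(θ_x - θ_{x+1}) ≤ 4π²/ℓ²` (the difference is
`0` or `±α`): only the two boundary bonds are twisted. Tasaki (2022) §3.1 (`U(1)` invariance,
eq. (3.1)–(3.2)). [cite: Tasaki2022, §3.1 Lemma 3.1 (proof)] -/
theorem bond_phase_twistW_le {α : ℝ} (hα : |α| ≤ 2 * Real.pi / ℓ)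
    (x y : ↥(Finset.Icc (0 : Site 1) ((ℓ : Site 1) + 1))) :
    2 - 2 * Real.cos
      ((if _hx : (x : Site 1) ∈ Finset.Icc (1 : Site 1) (ℓ : Site 1) then α else 0) -
        (if _hy : (y : Site 1) ∈ Finset.Icc (1 : Site 1) (ℓ : Site 1) then α else 0)) ≤
      4 * Real.pi ^ 2 / ℓ ^ 2 := by
  have hα2 : α ^ 2 ≤ 4 * Real.pi ^ 2 / ℓ ^ 2 := by
    have h := sq_le_sq' (abs_le.1 hα).1 (abs_le.1 hα).2
    calc α ^ 2 ≤ (2 * Real.pi / ℓ) ^ 2 := h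
      _ = 4 * Real.pi ^ 2 / ℓ ^ 2 := by ring
  have hB0 : 0 ≤ 4 * Real.pi ^ 2 / ℓ ^ 2 := by positivity
  split_ifs
  · rw [sub_self, Real.cos_zero]; linarith
  · rw [sub_zero]; exact (two_sub_two_mul_cos_le_sq α).trans hα2
  · rw [zero_sub, Real.cos_neg]; exact (two_sub_two_mul_cos_le_sq α).trans hα2
  · rw [sub_zero, Real.cos_zero]; linarith

variable {n J}

/-- **The local twist costs little energy** (Tasaki 2022, Lemma 3.1 with Lemma 3.2, for the chain):
for the unique gapped ground state (gap `γ`),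
`γ (1 - |ω(Û_ℓ)|²) ≤ |J| |c₀| (ℓ+2) · 4π²/ℓ²`, `c₀ = ω(Sˣ_0Sˣ_1 + Sʸ_0Sʸ_1)`.
[cite: Tasaki2022, §3.1 Lemma 3.2] -/
theorem gap_mul_le_twistU {γ : ℝ} {ω : InfVolState 1 (n + 1)}
    (hgap : ω.IsGappedGroundState (heisenbergInteraction n J) 1 γ)
    (hU : HasUniqueGroundState (heisenbergInteraction n J) 1) (hℓ : 1 ≤ ℓ) :
    γ * (1 - ‖ω.expect (Finset.Icc (1 : Site 1) (ℓ : Site 1))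
      (twistOp fun x : ↥(Finset.Icc (1 : Site 1) (ℓ : Site 1)) =>
        2 * Real.pi * ((x : Site 1) 0 : ℝ) / ℓ)‖ ^ 2) ≤
      |J| * ‖ω.expect {0, 1}
        (spinBond n 0 (⟨0, mem_insert_self 0 {1}⟩ : ↥({0, 1} : Finset (Site 1)))
            ⟨1, mem_insert_of_mem (mem_singleton_self 1)⟩ +
          spinBond n 1 (⟨0, mem_insert_self 0 {1}⟩ : ↥({0, 1} : Finset (Site 1)))
            ⟨1, mem_insert_of_mem (mem_singleton_self 1)⟩)‖ *
        ((ℓ + 2 : ℕ) * (4 * Real.pi ^ 2 / ℓ ^ 2)) := by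
  have h := hgap.gap_mul_le_twist n hU (thicken_Icc_subset ℓ)
    (fun x : ↥(Finset.Icc (1 : Site 1) (ℓ : Site 1)) => 2 * Real.pi * ((x : Site 1) 0 : ℝ) / ℓ)
    (B := 4 * Real.pi ^ 2 / ℓ ^ 2) (by positivity) (bond_phase_twistU_le ℓ hℓ)
  rwa [card_Icc_stage] at h

/-- **The uniform rotation of the block costs little energy**: for `|α| ≤ 2π/ℓ`,
`γ (1 - |ω(Ŵ_α)|²) ≤ |J| |c₀| (ℓ+2) · 4π²/ℓ²` (only the two boundary bonds are twisted, each by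
at most `2π/ℓ`). Tasaki (2022) Lemma 3.1/3.2 applied to the `U(1)` rotation `Û^I_θ` of §3.1.
[cite: Tasaki2022, §3.1 Lemma 3.2] -/
theorem gap_mul_le_twistW {γ : ℝ} {ω : InfVolState 1 (n + 1)}
    (hgap : ω.IsGappedGroundState (heisenbergInteraction n J) 1 γ)
    (hU : HasUniqueGroundState (heisenbergInteraction n J) 1) {α : ℝ}
    (hα : |α| ≤ 2 * Real.pi / ℓ) :
    γ * (1 - ‖ω.expect (Finset.Icc (1 : Site 1) (ℓ : Site 1))
      (twistOp fun _ : ↥(Finset.Icc (1 : Site 1) (ℓ : Site 1)) => α)‖ ^ 2) ≤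
      |J| * ‖ω.expect {0, 1}
        (spinBond n 0 (⟨0, mem_insert_self 0 {1}⟩ : ↥({0, 1} : Finset (Site 1)))
            ⟨1, mem_insert_of_mem (mem_singleton_self 1)⟩ +
          spinBond n 1 (⟨0, mem_insert_self 0 {1}⟩ : ↥({0, 1} : Finset (Site 1)))
            ⟨1, mem_insert_of_mem (mem_singleton_self 1)⟩)‖ *
        ((ℓ + 2 : ℕ) * (4 * Real.pi ^ 2 / ℓ ^ 2)) := by
  have h := hgap.gap_mul_le_twist n hU (thicken_Icc_subset ℓ)
    (fun _ : ↥(Finset.Icc (1 : Site 1) (ℓ : Site 1)) => α)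
    (B := 4 * Real.pi ^ 2 / ℓ ^ 2) (by positivity) (fun x y _ => bond_phase_twistW_le ℓ hα x y)
  rwa [card_Icc_stage] at h

/-! ### Near-eigenvector estimate for the twist and its translate; reality from the flip -/

/-- **The twist and its translate are nearly parallel in a near-eigenstate.** With
`a = ω(Û_ℓ)`, translation invariance (`ω(𝒯₁ Û_ℓ) = a`) and the near-eigenvector estimate
(Cauchy–Schwarz) give `re ω(Û_ℓᴴ 𝒯₁(Û_ℓ)) ≥ |a|² - (1 - |a|²)^{1/2}` (expectations on the stage
`{0,…,ℓ+1}`). This is the step `ω(Û_{x,ℓ}) ≃ e^{i2πxν} ω(Û_{0,ℓ})` of Tasaki (2022), proof of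
Lemma 3.3, in the form needed here. [cite: Tasaki2022, §3.2 Lemma 3.3 (proof)] -/
theorem re_expect_twistU_translate_ge {ω : InfVolState 1 (n + 1)}
    (hU : HasUniqueGroundState (heisenbergInteraction n J) 1)
    (hω : ω ∈ groundStates (heisenbergInteraction n J) 1) :
    ‖ω.expect (Finset.Icc (1 : Site 1) (ℓ : Site 1))
        (twistOp fun x : ↥(Finset.Icc (1 : Site 1) (ℓ : Site 1)) =>
          2 * Real.pi * ((x : Site 1) 0 : ℝ) / ℓ)‖ ^ 2 -
      √(1 - ‖ω.expect (Finset.Icc (1 : Site 1) (ℓ : Site 1))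
        (twistOp fun x : ↥(Finset.Icc (1 : Site 1) (ℓ : Site 1)) =>
          2 * Real.pi * ((x : Site 1) 0 : ℝ) / ℓ)‖ ^ 2) ≤
    (ω.expect (Finset.Icc (0 : Site 1) ((ℓ : Site 1) + 1))
      ((embedOp (Icc_subset_Icc' ℓ) (twistOp fun x : ↥(Finset.Icc (1 : Site 1) (ℓ : Site 1)) =>
          2 * Real.pi * ((x : Site 1) 0 : ℝ) / ℓ) :
            Op ↥(Finset.Icc (0 : Site 1) ((ℓ : Site 1) + 1)) (n + 1))ᴴ *
        embedOp (map_shift_Icc_subset ℓ)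
          (transportOp (finsetMapEquiv (Site.shift (1 : Site 1)).toEmbedding
            (Finset.Icc (1 : Site 1) (ℓ : Site 1)))
            (twistOp fun x : ↥(Finset.Icc (1 : Site 1) (ℓ : Site 1)) =>
              2 * Real.pi * ((x : Site 1) 0 : ℝ) / ℓ)))).re := by
  set Λ := Finset.Icc (1 : Site 1) (ℓ : Site 1) with hΛ
  set Λ' := Finset.Icc (0 : Site 1) ((ℓ : Site 1) + 1) with hΛ'
  set U : Op ↥Λ (n + 1) := twistOp fun x : ↥Λ => 2 * Real.pi * ((x : Site 1) 0 : ℝ) / ℓ with hUdef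
  set a := ω.expect Λ U with ha
  set Ut := embedOp (Icc_subset_Icc' ℓ) U with hUt
  set Vt := embedOp (map_shift_Icc_subset ℓ)
    (transportOp (finsetMapEquiv (Site.shift (1 : Site 1)).toEmbedding Λ) U) with hVt
  have hUU : Uᴴ * U = 1 := twistOp_conjTranspose_mul_self _
  have hUt1 : Utᴴ * Ut = 1 := by
    rw [hUt, ← embedOp_conjTranspose, ← embedOp_mul, hUU, embedOp_one]
  have hVt1 : Vtᴴ * Vt = 1 := by
    rw [hVt, ← embedOp_conjTranspose, ← embedOp_mul, ← transportOp_conjTranspose,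
      ← transportOp_mul, hUU, transportOp, reindex_apply, submatrix_one_equiv, embedOp_one]
  have hωUt : ω.expect Λ' Ut = a := by rw [hUt, ω.compatible]
  have hωVt : ω.expect Λ' Vt = a := by
    rw [hVt, ω.compatible, hU.expect_shift_heisenberg n hω (1 : Site 1) Λ U]
  have h := ω.norm_expect_conjTranspose_mul_sub_le Λ' Ut Vt
  rw [hUt1, hVt1, ω.expect_one, Complex.one_re, Real.sqrt_one, mul_one, hωUt, hωVt] at h
  -- `|z - |a|²| ≤ √(1-|a|²)` gives `re z ≥ |a|² - √(1-|a|²)`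
  have hre : -‖ω.expect Λ' (Utᴴ * Vt) - (starRingEnd ℂ) a * a‖ ≤
      (ω.expect Λ' (Utᴴ * Vt) - (starRingEnd ℂ) a * a).re :=
    (abs_le.1 (Complex.abs_re_le_norm _)).1
  rw [Complex.sub_re, Complex.mul_re, Complex.conj_re, Complex.conj_im] at hre
  have haa : a.re * a.re - -a.im * a.im = ‖a‖ ^ 2 := by
    rw [Complex.sq_norm, Complex.normSq_apply]; ring
  show ‖a‖ ^ 2 - √(1 - ‖a‖ ^ 2) ≤ (ω.expect Λ' (Utᴴ * Vt)).re
  linarith [hre, haa]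

/-- **Reality of the centred rotation average.** For the unique ground state of the chain,
`conj (e^{inℓα/2} ω(Ŵ_α)) = e^{inℓα/2} ω(Ŵ_α)`: flip invariance gives
`ω(Ŵ_α) = ω(flip Ŵ_α) = e^{-inℓα} ω(Ŵ_{-α})` (`flipOp_twistOp`, `#{1,…,ℓ} = ℓ`) and Hermiticity
gives `ω(Ŵ_{-α}) = ω(Ŵ_αᴴ) = conj ω(Ŵ_α)`. (With `Ŝᶻ`-centred generators: the average of
`exp[-iα Σ Ŝᶻ_x]` is real — the `ℤ₂` of `U(1) ⋊ ℤ₂` forcing `ω(Ŝᶻ) = 0`, Tasaki 2022 before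
Cor. 3.6.) [cite: Tasaki2022, §3 (before Cor. 3.6)] -/
theorem conj_expect_twistW {ω : InfVolState 1 (n + 1)}
    (hU : HasUniqueGroundState (heisenbergInteraction n J) 1)
    (hω : ω ∈ groundStates (heisenbergInteraction n J) 1) (α : ℝ) :
    (starRingEnd ℂ) (Complex.exp (I * ((n : ℝ) * ℓ * α / 2 : ℝ)) *
        ω.expect (Finset.Icc (1 : Site 1) (ℓ : Site 1))
          (twistOp fun _ : ↥(Finset.Icc (1 : Site 1) (ℓ : Site 1)) => α)) =
      Complex.exp (I * ((n : ℝ) * ℓ * α / 2 : ℝ)) *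
        ω.expect (Finset.Icc (1 : Site 1) (ℓ : Site 1))
          (twistOp fun _ : ↥(Finset.Icc (1 : Site 1) (ℓ : Site 1)) => α) := by
  set Λ := Finset.Icc (1 : Site 1) (ℓ : Site 1) with hΛ
  set z := ω.expect Λ (twistOp fun _ : ↥Λ => α) with hz
  -- flip invariance: `z = e^{-inℓα} ω(W_{-α})`, Hermiticity: `ω(W_{-α}) = conj z`
  have hflip := hU.expect_flipOp_heisenberg n hω Λ (twistOp fun _ : ↥Λ => α)
  have hcard : Λ.card = ℓ := card_Icc_block ℓ
  simp only [flipOp_twistOp, map_smul, smul_eq_mul, sum_const, Finset.card_univ, Fintype.card_coe,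
    hcard, nsmul_eq_mul] at hflip
  have hherm : ω.expect Λ (twistOp (-fun _ : ↥Λ => α)) = (starRingEnd ℂ) z := by
    rw [← twistOp_conjTranspose, hz]
    exact ω.expect_conjTranspose_holds Λ _
  rw [hherm, ← hz] at hflip
  -- with `u = e^{inℓα/2}`: `conj u = e^{-inℓα/2}`, `conj u ^ 2 = e^{-inℓα}`, `u conj u = 1`
  set u := Complex.exp (I * ((n : ℝ) * ℓ * α / 2 : ℝ)) with hu
  have hcu : (starRingEnd ℂ) u = Complex.exp (-(I * ((n : ℝ) * ℓ * α / 2 : ℝ))) := by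
    rw [hu, ← Complex.exp_conj, map_mul, Complex.conj_I, Complex.conj_ofReal, neg_mul]
  have hu2 : Complex.exp (-(I * ((n : ℝ) * ((ℓ : ℝ) * α) : ℝ))) =
      (starRingEnd ℂ) u * (starRingEnd ℂ) u := by
    rw [hcu, ← Complex.exp_add]
    congr 1
    push_cast
    ring
  have huu : u * (starRingEnd ℂ) u = 1 := by
    rw [hcu, hu, ← Complex.exp_add, add_neg_cancel, Complex.exp_zero]
  show (starRingEnd ℂ) (u * z) = u * z
  rw [map_mul]
  have h1 : z = (starRingEnd ℂ) u * (starRingEnd ℂ) u * (starRingEnd ℂ) z := by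
    rw [← hu2]; exact hflip.symm
  calc (starRingEnd ℂ) u * (starRingEnd ℂ) z
      = (u * (starRingEnd ℂ) u) * ((starRingEnd ℂ) u * (starRingEnd ℂ) z) := by
        rw [huu, one_mul]
    _ = u * ((starRingEnd ℂ) u * (starRingEnd ℂ) u * (starRingEnd ℂ) z) := by ring
    _ = u * z := by rw [← h1]

end Chain

end Literature.MathematicalPhysics.QuantumLattice
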